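import Mathlib
import HarnessLib
import Summits.Ventures.LatticeQCDFlow.Scaling.PlaquettePeelingClosingBound

/-!
# LatticeQCDFlow / Scaling — the closing-section peeling bound for a BLOCK target:
# `Z_K ≤ Z_B · M^{k−s} · M₂^{s}` (`B ⊆ K`, `k = #(K ∖ B)`), the free-boundary form

HONEST FRAMING: exact (Metropolis-corrected) sampling algorithms for lattice gauge theory;
figures of merit are autocorrelation/cost numbers at stated couplings and volumes; no
continuum-physics claim.

Venture `LatticeQCDFlow` (cell pub-lqcd), topic `Scaling`, FANOUT row 30 (lean-1, GEN-26) — OUR WORK on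
THEORY-2.md §4 row C5.  `Scaling/PlaquettePeelingClosingBound` bounds the FULL partition function of
`(ℤ/L)^d` by `c^{#B} M^{k−s} M₂^{s}` for a ranked structure with a closing section of size `s`.  GEN-25's
free-boundary files (`BoxRankedMorseBound`, `BoxRankedMorseCount`, `BoxHeatBathSampler`) work with a BLOCK
weight `F_K = ∏_{p∈K} w(U_p)` (the plaquettes of a box, links outside free) and the sub-block proposal
`(F_B/Z_B)·Haar^{⊗E}`, `B ⊆ K`.  The peeling induction of `PlaquettePeelingClosingBound`
(`integral_prod_weight_mul_prod_closing_le`) is already block-free; here are its two consequences for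
`K` in place of `univ`:

* **`integral_prod_weight_box_le_of_closing`** — `Z_K ≤ c^{#B} · M^{#(K∖B)−s} · M₂^{s}` for `B ⊆ K` ranked with
  a closing section `S ⊆ K ∖ B`, `u(S) ⊆ B`;
* **`integral_prod_weight_box_div_le_of_closing`** — `Z_K/Z_B ≤ M^{#(K∖B)−s} M₂^{s}`.

With the box closing sections and the block-target sampler files this gives the free-boundary volume law
(in `d = 3`: one factor `M₂/M` per three unit cubes).  No `def`, no `sorry`, nothing cited as a fact.
-/

noncomputable section

namespace Summit.Ventures.LatticeQCDFlow.Theory2.Autoregressive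

open MeasureTheory Function Finset
open Literature.MathematicalPhysics.QuantumFieldTheory Literature.MathematicalPhysics.QuantumLattice
open Summit.Ventures.LatticeQCDFlow.Exactness

variable {d L : ℕ} [NeZero L] {G : Type*} [Group G] [TopologicalSpace G] [IsTopologicalGroup G]
  [CompactSpace G] [SecondCountableTopology G] [MeasurableSpace G] [BorelSpace G]

/-- **`Z_K ≤ c^{#B} · M^{k−s} · M₂^{s}` for a BLOCK target.**  `B ⊆ K` ranked with a closing section
`(S, u)` inside `K` (`S ⊆ K ∖ B`, `u(S) ⊆ B`; `k = #(K ∖ B)`, `s = #S`): the block partition function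
`Z_K = ∫ ∏_{p∈K} w(U_p) dHaar^{⊗E}` is at most `c^{#B} M^{k−s} M₂^{s}` — the free-boundary form of
`PlaquettePeelingClosingBound.integral_prod_weight_le_of_closing` (`K = univ`). [ours] -/
theorem integral_prod_weight_box_le_of_closing (hL : 2 ≤ L) {w : G → ℝ} (hw : Continuous w)
    {m M : ℝ} (hm0 : 0 < m) (hm : ∀ g, m ≤ w g) (hM : ∀ g, w g ≤ M) {M₂ : ℝ}
    (hM₂ : ∀ a b : G, ∫ h, w h * w (a * h * b) ∂(haarProbability G) ≤
      (∫ g, w g ∂(haarProbability G)) * M₂)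
    (hM₂' : ∀ a b : G, ∫ h, w h * w (a * h⁻¹ * b) ∂(haarProbability G) ≤
      (∫ g, w g ∂(haarProbability G)) * M₂)
    (B : Finset (Plaquette d L)) (t : Plaquette d L → Edge d L)
    (ht : ∀ p ∈ B, t p ∈ ({(p.1, p.2.1.1), (p.1.shift p.2.1.1, p.2.1.2),
        (p.1.shift p.2.1.2, p.2.1.1), (p.1, p.2.1.2)} : Finset (Edge d L)))
    (rank : Plaquette d L → ℕ)
    (hrank : ∀ p ∈ B, ∀ p' ∈ B, p ≠ p' → t p ∈ ({(p'.1, p'.2.1.1), (p'.1.shift p'.2.1.1, p'.2.1.2),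
        (p'.1.shift p'.2.1.2, p'.2.1.1), (p'.1, p'.2.1.2)} : Finset (Edge d L)) → rank p < rank p')
    (K : Finset (Plaquette d L)) (hBK : B ⊆ K)
    (S : Finset (Plaquette d L)) (u : Plaquette d L → Plaquette d L) (hSK : ∀ p' ∈ S, p' ∈ K)
    (hSB : ∀ p' ∈ S, p' ∉ B) (huB : ∀ p' ∈ S, u p' ∈ B)
    (hut : ∀ p' ∈ S, t (u p') ∈ ({(p'.1, p'.2.1.1), (p'.1.shift p'.2.1.1, p'.2.1.2),
        (p'.1.shift p'.2.1.2, p'.2.1.1), (p'.1, p'.2.1.2)} : Finset (Edge d L)))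
    (humax : ∀ p' ∈ S, ∀ p ∈ B, p ≠ u p' → t p ∈ ({(p'.1, p'.2.1.1), (p'.1.shift p'.2.1.1, p'.2.1.2),
        (p'.1.shift p'.2.1.2, p'.2.1.1), (p'.1, p'.2.1.2)} : Finset (Edge d L)) → rank p < rank (u p'))
    (huinj : Set.InjOn u S) :
    ∫ U, ∏ p ∈ K, w (plaquetteHolonomy U p.1 p.2.1.1 p.2.1.2)
        ∂(Measure.pi fun _ : Edge d L => haarProbability G) ≤
      (∫ g, w g ∂(haarProbability G)) ^ B.card * M ^ ((K \ B).card - S.card) *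
        M₂ ^ S.card := by
  classical
  have hw0 : ∀ g, 0 < w g := fun g => hm0.trans_le (hm g)
  have hMpos : 0 < M := (hw0 1).trans_le (hM 1)
  have hSsub : S ⊆ K \ B := fun p' hp' => Finset.mem_sdiff.2 ⟨hSK p' hp', hSB p' hp'⟩
  have hfilt : S.filter (fun p' => u p' ∈ B) = S := Finset.filter_true_of_mem fun p' hp' => huB p' hp'
  have hkey := integral_prod_weight_mul_prod_closing_le (G := G) hL hw hm0 hm hM hM₂ hM₂' B t ht rank
    hrank S u hSB hut humax huinj
  rw [hfilt] at hkey
  set FB : GaugeConfig d L G → ℝ := fun U => ∏ p ∈ B, w (plaquetteHolonomy U p.1 p.2.1.1 p.2.1.2)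
    with hFB
  set FS : GaugeConfig d L G → ℝ := fun U => ∏ p ∈ S, w (plaquetteHolonomy U p.1 p.2.1.1 p.2.1.2)
    with hFS
  set FO : GaugeConfig d L G → ℝ := fun U =>
    ∏ p ∈ (K \ B) \ S, w (plaquetteHolonomy U p.1 p.2.1.1 p.2.1.2) with hFO
  have hsplit : ∀ U, (∏ p ∈ K, w (plaquetteHolonomy U p.1 p.2.1.1 p.2.1.2)) =
      FO U * (FB U * FS U) := by
    intro U
    rw [← Finset.prod_sdiff hBK, ← Finset.prod_sdiff hSsub, hFO, hFB, hFS]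
    ring
  have hcard : ((K \ B) \ S).card = (K \ B).card - S.card :=
    Finset.card_sdiff_of_subset hSsub
  have hFOle : ∀ U, FO U ≤ M ^ ((K \ B).card - S.card) := by
    intro U
    rw [hFO, ← hcard, ← Finset.prod_const]
    exact Finset.prod_le_prod (fun p _ => (hw0 _).le) fun p _ => hM _
  have hprodpos : ∀ U, 0 < FB U * FS U := fun U =>
    mul_pos (prod_pos fun p _ => hw0 _) (prod_pos fun p _ => hw0 _)
  have hmeas : Measurable fun U : GaugeConfig d L G => FB U * FS U :=
    (Finset.measurable_prod B fun p _ =>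
      hw.measurable.comp (measurable_plaquetteHolonomy p.1 p.2.1.1 p.2.1.2)).mul
    (Finset.measurable_prod S fun p _ =>
      hw.measurable.comp (measurable_plaquetteHolonomy p.1 p.2.1.1 p.2.1.2))
  haveI : IsProbabilityMeasure (Measure.pi fun _ : Edge d L => haarProbability G) := by infer_instance
  have hint : Integrable (fun U : GaugeConfig d L G => FB U * FS U)
      (Measure.pi fun _ : Edge d L => haarProbability G) := by
    refine Integrable.mono' (integrable_const (M ^ B.card * M ^ S.card)) hmeas.aestronglyMeasurable
      (ae_of_all _ fun U => ?_)
    rw [Real.norm_eq_abs, abs_of_pos (hprodpos U), hFB, hFS]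
    refine mul_le_mul ?_ ?_ (prod_pos fun p _ => hw0 _).le (pow_nonneg hMpos.le _)
    · rw [← Finset.prod_const]
      exact Finset.prod_le_prod (fun p _ => (hw0 _).le) fun p _ => hM _
    · rw [← Finset.prod_const]
      exact Finset.prod_le_prod (fun p _ => (hw0 _).le) fun p _ => hM _
  calc ∫ U, ∏ p ∈ K, w (plaquetteHolonomy U p.1 p.2.1.1 p.2.1.2)
          ∂(Measure.pi fun _ : Edge d L => haarProbability G)
      = ∫ U, FO U * (FB U * FS U) ∂(Measure.pi fun _ : Edge d L => haarProbability G) := by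
        simp_rw [hsplit]
    _ ≤ ∫ U, M ^ ((K \ B).card - S.card) * (FB U * FS U)
          ∂(Measure.pi fun _ : Edge d L => haarProbability G) :=
        integral_mono_of_nonneg
          (ae_of_all _ fun U => mul_nonneg (prod_pos fun p _ => hw0 _).le (hprodpos U).le)
          (hint.const_mul _)
          (ae_of_all _ fun U => mul_le_mul_of_nonneg_right (hFOle U) (hprodpos U).le)
    _ = M ^ ((K \ B).card - S.card) *
          ∫ U, FB U * FS U ∂(Measure.pi fun _ : Edge d L => haarProbability G) := integral_const_mul _ _
    _ ≤ M ^ ((K \ B).card - S.card) * ((∫ g, w g ∂(haarProbability G)) ^ B.card * M₂ ^ S.card) :=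
        mul_le_mul_of_nonneg_left hkey (pow_nonneg hMpos.le _)
    _ = (∫ g, w g ∂(haarProbability G)) ^ B.card * M ^ ((K \ B).card - S.card) *
          M₂ ^ S.card := by ring

/-- **`Z_K/Z_B ≤ M^{k−s} · M₂^{s}`** for the block target `K ⊇ B` — the normalising constant of the
sub-block proposal's density ratio (`BoxHeatBathSampler`), with `Z_B = c^{#B}` by GEN-23's peeling. [ours] -/
theorem integral_prod_weight_box_div_le_of_closing (hL : 2 ≤ L) {w : G → ℝ} (hw : Continuous w)
    {m M : ℝ} (hm0 : 0 < m) (hm : ∀ g, m ≤ w g) (hM : ∀ g, w g ≤ M) {M₂ : ℝ}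
    (hM₂ : ∀ a b : G, ∫ h, w h * w (a * h * b) ∂(haarProbability G) ≤
      (∫ g, w g ∂(haarProbability G)) * M₂)
    (hM₂' : ∀ a b : G, ∫ h, w h * w (a * h⁻¹ * b) ∂(haarProbability G) ≤
      (∫ g, w g ∂(haarProbability G)) * M₂)
    (B : Finset (Plaquette d L)) (t : Plaquette d L → Edge d L)
    (ht : ∀ p ∈ B, t p ∈ ({(p.1, p.2.1.1), (p.1.shift p.2.1.1, p.2.1.2),
        (p.1.shift p.2.1.2, p.2.1.1), (p.1, p.2.1.2)} : Finset (Edge d L)))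
    (rank : Plaquette d L → ℕ)
    (hrank : ∀ p ∈ B, ∀ p' ∈ B, p ≠ p' → t p ∈ ({(p'.1, p'.2.1.1), (p'.1.shift p'.2.1.1, p'.2.1.2),
        (p'.1.shift p'.2.1.2, p'.2.1.1), (p'.1, p'.2.1.2)} : Finset (Edge d L)) → rank p < rank p')
    (K : Finset (Plaquette d L)) (hBK : B ⊆ K)
    (S : Finset (Plaquette d L)) (u : Plaquette d L → Plaquette d L) (hSK : ∀ p' ∈ S, p' ∈ K)
    (hSB : ∀ p' ∈ S, p' ∉ B) (huB : ∀ p' ∈ S, u p' ∈ B)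
    (hut : ∀ p' ∈ S, t (u p') ∈ ({(p'.1, p'.2.1.1), (p'.1.shift p'.2.1.1, p'.2.1.2),
        (p'.1.shift p'.2.1.2, p'.2.1.1), (p'.1, p'.2.1.2)} : Finset (Edge d L)))
    (humax : ∀ p' ∈ S, ∀ p ∈ B, p ≠ u p' → t p ∈ ({(p'.1, p'.2.1.1), (p'.1.shift p'.2.1.1, p'.2.1.2),
        (p'.1.shift p'.2.1.2, p'.2.1.1), (p'.1, p'.2.1.2)} : Finset (Edge d L)) → rank p < rank (u p'))
    (huinj : Set.InjOn u S) :
    (∫ U, ∏ p ∈ K, w (plaquetteHolonomy U p.1 p.2.1.1 p.2.1.2)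
        ∂(Measure.pi fun _ : Edge d L => haarProbability G)) /
      (∫ U, ∏ p ∈ B, w (plaquetteHolonomy U p.1 p.2.1.1 p.2.1.2)
        ∂(Measure.pi fun _ : Edge d L => haarProbability G)) ≤
      M ^ ((K \ B).card - S.card) * M₂ ^ S.card := by
  have hw0 : ∀ g, 0 < w g := fun g => hm0.trans_le (hm g)
  have hc : 0 < ∫ g, w g ∂(haarProbability G) := haarProbability_integral_pos_of_continuous_pos hw hw0
  rw [integral_prod_weight_eq_pow_of_rank (G := G) hL hw hm0 hm hM B t ht rank hrank,
    div_le_iff₀ (pow_pos hc _)]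
  calc ∫ U, ∏ p ∈ K, w (plaquetteHolonomy U p.1 p.2.1.1 p.2.1.2)
          ∂(Measure.pi fun _ : Edge d L => haarProbability G)
      ≤ (∫ g, w g ∂(haarProbability G)) ^ B.card * M ^ ((K \ B).card - S.card) *
          M₂ ^ S.card :=
        integral_prod_weight_box_le_of_closing (G := G) hL hw hm0 hm hM hM₂ hM₂' B t ht rank hrank K hBK S u
          hSK hSB huB hut humax huinj
    _ = M ^ ((K \ B).card - S.card) * M₂ ^ S.card *
          (∫ g, w g ∂(haarProbability G)) ^ B.card := by ring


end Summit.Ventures.LatticeQCDFlow.Theory2.Autoregressive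

end
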